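import Literature.Computability.Complexity.AdaptiveFunctions
import Literature.Computability.Complexity.FoldBricks
import HarnessLib

/-!
# Adaptive oracle programs: the `FP`-brick algebra relativised to a language oracle

Topic `Computability/Complexity`, continuing `AdaptiveFunctions.lean` (`AdQuery.adFn Q q G A`: ask the
`q(|x|)` adaptive queries `Q ⟨x, answers so far⟩`, then output `G ⟨x, answers⟩`; `adFn_mem_FPRel`:
such a function is in `FP^A` for `Q, G ∈ FP`). Machines in the tree are written in the `FP`-brick
algebra (`BrickAlgebra.lean`, `PlumbingBricks.lean`, `FoldBricks.lean`, `IterateFP.lean`): a program is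
a composite of `FP` bricks under `∘`, `fanoutFn`, `iteFn` and clocked iteration, and its polynomial
time is the composite of the closure lemmas `comp_mem_FP`, `fanoutFn_mem_FP`, `iterate_mem_FP`. A
**reduction that runs an adversary as a subroutine** (Håstad–Impagliazzo–Levin–Luby 1999, Def. 3.6.1:
the adversary `A` enters the oracle machine `M^{(A)}` only as a function it may call; Goldreich 2001,
§3.6; Arora–Barak 2009, §3.4) is such a program in which ONE brick is an oracle call. This file
relativises the algebra so that those programs, and their existing `FP` proofs, transfer verbatim to
the oracle setting:

* `AdQuery.AdPres A h` — `h` is **presented by an adaptive `FP` program over the language `A`**: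
  `h x = G ⟨x, adBits Q A x (q|x|)⟩` for some `Q, G ∈ FP` and polynomial `q` (so `h ∈ FP^A`,
  `AdPres.mem_FPRel`);
* the bricks: every `FP` function (`AdPres.of_mem_FP`) and the oracle call `x ↦ [f x ∈ A]` for
  `f ∈ FP` (`AdPres.query`, `AdPres.oracle`);
* the combinators: `FP` pre/post-processing with the argument kept (`AdPres.postPre`), composition
  (`AdPres.comp` — run the first program, then the second on its output, the round budget padded to a
  polynomial of the original input and the answer string cut accordingly), `fanoutFn`
  (`AdPres.fanout`), branching on a computed bit (`AdPres.ite`), and **clocked iteration**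
  (`AdPres.iterate`: `z ↦ F^[p(|z.1|)] z` for `F` of additive growth, the analogue of
  `iterate_mem_FP` — each round of `F` is allotted a block of `R(|z|)` answer bits, the unused tail of
  a block being filled with dummy queries, and the query generator replays the earlier rounds from the
  answer blocks to find the current state).

Every statement is an equation `h x = G ⟨x, adBits Q A x (q|x|)⟩` for explicit bricks `Q, G`; the
proofs are bookkeeping on the answer string (`adBits_take`, `adBits_congr_left`). Consumers:
relativised security reductions (the Goldreich–Levin inverter run against an oracle distinguisher),
where an `FP` program of the tree is re-read with the adversary brick an oracle call.

## References

* R. E. Ladner, N. A. Lynch, A. L. Selman, *A comparison of polynomial time reducibilities*,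
  Theoret. Comput. Sci. 1 (1975) 103–123, §2 (`≤ᵖ_T`: the next query is computed from the input and
  the previous answers).
* S. Arora, B. Barak, *Computational Complexity: A Modern Approach*, CUP 2009, §3.4 (oracle machines),
  §1.3 and §1.4.1 (composition, bounded and clocked loops).
* J. Håstad, R. Impagliazzo, L. A. Levin, M. Luby, *A pseudorandom generator from any one-way
  function*, SIAM J. Comput. 28 (1999) 1364–1396, Def. 3.6.1 (adversaries as oracles of the reduction).
* O. Goldreich, *Foundations of Cryptography I*, CUP 2001, §3.6 (probabilistic polynomial-time oracle
  machines).
-/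

namespace Literature.Computability.Complexity

open _root_.Computability Polynomial OracleCompose PRelSigma Brick Plumb

namespace AdQuery

/-! ### Answer-string bookkeeping -/

/-- Two query generators that agree along the answer string of the second produce the same answer
string. [folklore] -/
theorem adBits_congr_left {Q Q' : List Bool → List Bool} {A : Language Bool} {x x' : List Bool} :
    ∀ {i : ℕ}, (∀ j < i, Q (boolPair x (adBits Q' A x' j)) = Q' (boolPair x' (adBits Q' A x' j))) →
      adBits Q A x i = adBits Q' A x' i
  | 0, _ => rfl
  | i + 1, h => by
    have ih := adBits_congr_left (i := i) fun j hj => h j (Nat.lt_succ_of_lt hj)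
    rw [adBits_succ, adBits_succ, ih, h i i.lt_succ_self]

/-- `ones n` has length `n`. [folklore] -/
private theorem length_ones (n : ℕ) : (ones n).length = n := List.length_replicate ..

/-- The identity is in `FP`. [folklore] -/
private theorem id_mem_FP' : (fun w : List Bool => w) ∈ FP := PolyTimeComputable.id _

/-- `(l ⇂ m) ↾ j = (l ↾ (m + j)) ⇂ m`. [folklore] -/
private theorem take_drop_eq {α : Type*} : ∀ (l : List α) (m j : ℕ), (l.drop m).take j = (l.take (m + j)).drop m
  | [], m, j => by simp
  | a :: l, 0, j => by simp
  | a :: l, m + 1, j => by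
    rw [show m + 1 + j = (m + j) + 1 by omega, List.take_succ_cons, List.drop_succ_cons, List.drop_succ_cons, take_drop_eq l m j]

/-! ### Presentations -/

/-- **`h` is presented by an adaptive `FP` program over the language oracle `A`**: for some query
generator `Q ∈ FP`, output map `G ∈ FP` and polynomial round budget `q`,
`h x = G ⟨x, b₀ ⋯ b_{q(|x|)-1}⟩` with `bᵢ = [Q ⟨x, b₀ ⋯ b_{i-1}⟩ ∈ A]` — i.e. `h = adFn Q q G A`.
[Ladner–Lynch–Selman 1975, §2; Arora–Barak 2009, §3.4] [cite: LadnerLynchSelman1975, §2] -/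
def AdPres (A : Language Bool) (h : List Bool → List Bool) : Prop :=
  ∃ Q G : List Bool → List Bool, ∃ q : Polynomial ℕ,
    Q ∈ FP ∧ G ∈ FP ∧ ∀ x, h x = G (boolPair x (adBits Q A x (q.eval x.length)))

namespace AdPres

variable {A : Language Bool}

/-- A presented function is `adFn Q q G A`. [folklore] -/
theorem eq_adFn {h : List Bool → List Bool} {Q G : List Bool → List Bool} {q : Polynomial ℕ}
    (heq : ∀ x, h x = G (boolPair x (adBits Q A x (q.eval x.length)))) : h = adFn Q q G A :=
  funext fun x => by rw [heq, adFn_apply]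

/-- **A presented function is in `FP^A`** (`adFn_mem_FPRel`). [cite: LadnerLynchSelman1975, §2] -/
theorem mem_FPRel {h : List Bool → List Bool} (hh : AdPres A h) : h ∈ FPRel (Oracle.ofLanguage A) := by
  obtain ⟨Q, G, q, hQ, hG, heq⟩ := hh
  rw [eq_adFn heq]
  exact adFn_mem_FPRel hQ hG A

/-- **Every `FP` function is presented** (no queries). [cite: AroraBarak2009, §3.4] -/
theorem of_mem_FP {h : List Bool → List Bool} (hh : h ∈ FP) : AdPres A h :=
  ⟨fstF, h ∘ fstF, 0, fstF_mem_FP, comp_mem_FP hh fstF_mem_FP, fun x => by simp⟩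

/-- **The oracle call is presented**: `x ↦ [f x ∈ A]` for `f ∈ FP` (one query). [cite: AroraBarak2009, §3.4] -/
theorem query {f : List Bool → List Bool} (hf : f ∈ FP) : AdPres A (fun x => [A.boolIndicator (f x)]) :=
  ⟨f ∘ fstF, sndF, 1, comp_mem_FP hf fstF_mem_FP, sndF_mem_FP, fun x => by
    rw [eval_one, show (1 : ℕ) = 0 + 1 from rfl, adBits_succ, adBits_zero]
    simp⟩

/-- The oracle of the language, as a string function, is presented. [cite: AroraBarak2009, §3.4] -/
theorem oracle : AdPres A (Oracle.ofLanguage A) := by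
  have h := query (A := A) id_mem_FP'
  have he : Oracle.ofLanguage A = fun x => [A.boolIndicator ((fun w : List Bool => w) x)] := funext fun x => ofLanguage_eq_singleton A x
  rw [he]
  exact h

/-! ### `FP` pre- and post-processing, the argument kept -/

/-- **`w ↦ post ⟨w, f (pre w)⟩` is presented** for presented `f` and `pre, post ∈ FP` (the analogue of
`postPre_mem_FPRel`): query as `f` does on `pre w`, with the round budget `q ∘ s` for an output bound
`s` of `pre`, and cut the answers to `q(|pre w|)`. [cite: AroraBarak2009, §3.4 (Example 3.6 (2))] -/
theorem postPre {f pre post : List Bool → List Bool} (hf : AdPres A f) (hpre : pre ∈ FP) (hpost : post ∈ FP) :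
    AdPres A (fun w => post (boolPair w (f (pre w)))) := by
  obtain ⟨Q, G, q, hQ, hG, hfx⟩ := hf
  obtain ⟨s, hs⟩ := exists_poly_length_le_of_mem_FP hpre
  refine ⟨Q ∘ fanoutFn (pre ∘ fstF) sndF,
    post ∘ fanoutFn fstF (G ∘ fanoutFn (pre ∘ fstF) (takeFn ∘ fanoutFn (polyFn q ∘ pre ∘ fstF) sndF)), q.comp s,
    comp_mem_FP hQ (fanoutFn_mem_FP (comp_mem_FP hpre fstF_mem_FP) sndF_mem_FP),
    comp_mem_FP hpost (fanoutFn_mem_FP fstF_mem_FP (comp_mem_FP hG (fanoutFn_mem_FP (comp_mem_FP hpre fstF_mem_FP)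
      (comp_mem_FP takeFn_mem_FP (fanoutFn_mem_FP (comp_mem_FP (polyFn_mem_FP q) (comp_mem_FP hpre fstF_mem_FP)) sndF_mem_FP))))),
    fun w => ?_⟩
  have hbits : ∀ i, adBits (Q ∘ fanoutFn (pre ∘ fstF) sndF) A w i = adBits Q A (pre w) i := fun i =>
    adBits_congr_left fun j _ => by simp
  have hle : q.eval (pre w).length ≤ (q.comp s).eval w.length := by
    rw [eval_comp]; exact TM2Iter.eval_mono q (hs w)
  simp only [Function.comp_apply, fanoutFn_apply, fstF_boolPair, sndF_boolPair, polyFn_apply, takeFn_boolPair, length_ones,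
    hbits, adBits_take A (pre w) hle, hfx (pre w)]

/-- `f ∘ pre` is presented for presented `f` and `pre ∈ FP`. [cite: AroraBarak2009, §3.4] -/
theorem comp_FP {f pre : List Bool → List Bool} (hf : AdPres A f) (hpre : pre ∈ FP) : AdPres A (f ∘ pre) := by
  have h := postPre hf hpre sndF_mem_FP
  simp only [sndF_boolPair] at h
  exact h

/-- `post ∘ f` is presented for presented `f` and `post ∈ FP`. [cite: AroraBarak2009, §3.4] -/
theorem FP_comp {f post : List Bool → List Bool} (hf : AdPres A f) (hpost : post ∈ FP) : AdPres A (post ∘ f) := by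
  have h := postPre hf id_mem_FP' (comp_mem_FP hpost sndF_mem_FP)
  simp only [Function.comp_apply, sndF_boolPair] at h
  exact h

/-! ### Composition -/

/-- **Composition of presented functions is presented.** Program for `f ∘ g` on `x`: the first
`m = q₁(|x|)` rounds are those of `g` (`Q₁`); afterwards the value `v = G₁ ⟨x, first m answers⟩ = g x`
is recomputed from the answers and the rounds are those of `f` on `v` (`Q₂ ⟨v, later answers⟩`);
the budget is `q₁ + q₂ ∘ s` for an output bound `s` of `v` in `|x|`, and the output map feeds `G₂`
the `q₂(|v|)` answers after position `m`. [cite: AroraBarak2009, §3.4 with §1.3 (composition)] -/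
theorem comp {f g : List Bool → List Bool} (hf : AdPres A f) (hg : AdPres A g) : AdPres A (f ∘ g) := by
  obtain ⟨Q₁, G₁, q₁, hQ₁, hG₁, hgx⟩ := hg
  obtain ⟨Q₂, G₂, q₂, hQ₂, hG₂, hfx⟩ := hf
  obtain ⟨sG, hsG⟩ := exists_poly_length_le_of_mem_FP hG₁
  -- bricks on `w = ⟨x, bs⟩`: `M w = 1^{q₁|x|}`, `V w = G₁ ⟨x, bs ↾ m⟩`, `R w = bs ⇂ m`, `T w = [|bs| < m]`
  have hM : (polyFn q₁ ∘ fstF) ∈ FP := comp_mem_FP (polyFn_mem_FP q₁) fstF_mem_FP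
  have hV : (G₁ ∘ fanoutFn fstF (takeFn ∘ fanoutFn (polyFn q₁ ∘ fstF) sndF)) ∈ FP :=
    comp_mem_FP hG₁ (fanoutFn_mem_FP fstF_mem_FP (comp_mem_FP takeFn_mem_FP (fanoutFn_mem_FP hM sndF_mem_FP)))
  have hR : (dropFn ∘ fanoutFn (polyFn q₁ ∘ fstF) sndF) ∈ FP := comp_mem_FP dropFn_mem_FP (fanoutFn_mem_FP hM sndF_mem_FP)
  have hT : (ltLenF ∘ fanoutFn sndF (polyFn q₁ ∘ fstF)) ∈ FP := comp_mem_FP ltLenF_mem_FP (fanoutFn_mem_FP sndF_mem_FP hM)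
  refine ⟨iteFn (ltLenF ∘ fanoutFn sndF (polyFn q₁ ∘ fstF)) Q₁
      (Q₂ ∘ fanoutFn (G₁ ∘ fanoutFn fstF (takeFn ∘ fanoutFn (polyFn q₁ ∘ fstF) sndF)) (dropFn ∘ fanoutFn (polyFn q₁ ∘ fstF) sndF)),
    G₂ ∘ fanoutFn (G₁ ∘ fanoutFn fstF (takeFn ∘ fanoutFn (polyFn q₁ ∘ fstF) sndF))
      (takeFn ∘ fanoutFn (polyFn q₂ ∘ (G₁ ∘ fanoutFn fstF (takeFn ∘ fanoutFn (polyFn q₁ ∘ fstF) sndF)))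
        (dropFn ∘ fanoutFn (polyFn q₁ ∘ fstF) sndF)),
    q₁ + q₂.comp (sG.comp (2 * X + 2 + q₁)),
    iteFn_mem_FP hT hQ₁ (comp_mem_FP hQ₂ (fanoutFn_mem_FP hV hR)),
    comp_mem_FP hG₂ (fanoutFn_mem_FP hV (comp_mem_FP takeFn_mem_FP (fanoutFn_mem_FP (comp_mem_FP (polyFn_mem_FP q₂) hV) hR))),
    fun x => ?_⟩
  -- names
  set Q := iteFn (ltLenF ∘ fanoutFn sndF (polyFn q₁ ∘ fstF)) Q₁
      (Q₂ ∘ fanoutFn (G₁ ∘ fanoutFn fstF (takeFn ∘ fanoutFn (polyFn q₁ ∘ fstF) sndF)) (dropFn ∘ fanoutFn (polyFn q₁ ∘ fstF) sndF)) with hQdef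
  set m := q₁.eval x.length with hm
  set β := adBits Q₁ A x m with hβ
  set v := G₁ (boolPair x β) with hv
  have hlenβ : β.length = m := length_adBits A x m
  -- the value of `Q` on short and on long answer strings
  have hQ_lt : ∀ bs : List Bool, bs.length < m → Q (boolPair x bs) = Q₁ (boolPair x bs) := fun bs hbs => by
    rw [hQdef, iteFn_apply_true]
    simp [hbs, ← hm]
  have hQ_ge : ∀ γ : List Bool, Q (boolPair x (β ++ γ)) = Q₂ (boolPair v γ) := fun γ => by
    rw [hQdef, iteFn_apply_false]
    · simp only [Function.comp_apply, fanoutFn_apply, fstF_boolPair, sndF_boolPair, polyFn_apply, takeFn_boolPair, dropFn_boolPair,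
        length_ones, ← hm]
      rw [List.take_left' hlenβ, List.drop_left' hlenβ]
    · have : ¬ (β ++ γ).length < m := by rw [List.length_append, hlenβ]; omega
      simp only [Function.comp_apply, fanoutFn_apply, sndF_boolPair, fstF_boolPair, polyFn_apply, ltLenF_boolPair, length_ones, ← hm,
        this, decide_false]
  -- (a) the first `m` rounds are those of `g`
  have ha : ∀ i ≤ m, adBits Q A x i = adBits Q₁ A x i := fun i hi =>
    adBits_congr_left fun j hj => hQ_lt _ (by rw [length_adBits]; omega)
  -- (b) the next rounds are those of `f` on `v`
  have hb : ∀ j, adBits Q A x (m + j) = β ++ adBits Q₂ A v j := by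
    intro j
    induction j with
    | zero => rw [Nat.add_zero, ha m le_rfl, adBits_zero, List.append_nil]
    | succ j ih => rw [← Nat.add_assoc, adBits_succ, ih, adBits_succ, hQ_ge, List.append_assoc]
  -- (c) the output map reads `v` and the `q₂(|v|)` answers after position `m`
  have hvlen : q₂.eval v.length ≤ q₂.eval (sG.eval (2 * x.length + 2 + m)) :=
    TM2Iter.eval_mono q₂ ((hsG _).trans (le_of_eq (by rw [length_boolPair, hlenβ])))
  have hqx : (q₁ + q₂.comp (sG.comp (2 * X + 2 + q₁))).eval x.length = m + q₂.eval (sG.eval (2 * x.length + 2 + m)) := by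
    simp [← hm]
  rw [hqx]
  set J := q₂.eval (sG.eval (2 * x.length + 2 + m)) with hJ
  have htake : (adBits Q A x (m + J)).take m = β := by rw [adBits_take A x (Nat.le_add_right m J), ha m le_rfl]
  have hdrop : ((adBits Q A x (m + J)).drop m).take (q₂.eval v.length) = adBits Q₂ A v (q₂.eval v.length) := by
    rw [take_drop_eq, adBits_take A x (Nat.add_le_add_left hvlen m), hb, List.drop_left' hlenβ]
  rw [Function.comp_apply, hgx x, ← hm, ← hβ, ← hv]
  simp only [Function.comp_apply, fanoutFn_apply, fstF_boolPair, sndF_boolPair, polyFn_apply, takeFn_boolPair, dropFn_boolPair,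
    length_ones, ← hm, htake]
  rw [← hv, hdrop, ← hfx v]

/-! ### Fan-out and branching -/

/-- **`fanoutFn f g` is presented** for presented `f, g` (first `f`, then `g`, on the same input).
[cite: AroraBarak2009, §3.4 with §1.3] -/
theorem fanout {f g : List Bool → List Bool} (hf : AdPres A f) (hg : AdPres A g) : AdPres A (fanoutFn f g) := by
  -- `x ↦ ⟨f x, x⟩`, then `⟨a, x⟩ ↦ ⟨a, g x⟩`
  have h1 : AdPres A (fun x => fanoutFn sndF fstF (boolPair x (f ((fun w : List Bool => w) x)))) :=
    postPre hf id_mem_FP' (fanoutFn_mem_FP sndF_mem_FP fstF_mem_FP)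
  have h2 : AdPres A (fun w => fanoutFn (fstF ∘ fstF) sndF (boolPair w (g (sndF w)))) :=
    postPre hg sndF_mem_FP (fanoutFn_mem_FP (comp_mem_FP fstF_mem_FP fstF_mem_FP) sndF_mem_FP)
  have h := comp h2 h1
  have he : ((fun w => fanoutFn (fstF ∘ fstF) sndF (boolPair w (g (sndF w)))) ∘
      fun x => fanoutFn sndF fstF (boolPair x (f ((fun w : List Bool => w) x)))) = fanoutFn f g := by
    funext x; simp
  rwa [he] at h

/-- **`iteFn c f g` is presented** for presented `c, f, g`. [cite: AroraBarak2009, §3.4 with §1.3] -/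
theorem ite {c f g : List Bool → List Bool} (hc : AdPres A c) (hf : AdPres A f) (hg : AdPres A g) :
    AdPres A (iteFn c f g) := by
  have h := FP_comp (fanout hc (fanout hf hg)) Branching.sel2T.polyTimeComputable_eval
  have he : Branching.sel2T.eval ∘ fanoutFn c (fanoutFn f g) = iteFn c f g := by
    funext z; unfold iteFn; rfl
  rwa [he] at h

/-- A constant function is presented. [folklore] -/
theorem const (w : List Bool) : AdPres A (fun _ : List Bool => w) := of_mem_FP (const_mem_FP w)

/-- The identity is presented. [folklore] -/
protected theorem id : AdPres A (fun w : List Bool => w) := of_mem_FP id_mem_FP'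

/-! ### Clocked iteration -/

/-- **Polynomially many rounds of a presented function of additive growth are presented** (the
analogue of `iterate_mem_FP`): for presented `F` with `|F w| ≤ |w| + d` and a polynomial `p`, the
function `z ↦ F^[p(|z.1|)] z` is presented. Program: with `N = p(|z.1|)` rounds of `F` to simulate and
`R(|z|) = q(|z| + d·p(|z|))` an upper bound on the queries of any one of them (`|F^[i] z| ≤ |z| + d i`),
round `i` of `F` is allotted the `i`-th block of `R` answer bits — its own `q(|zᵢ|)` queries first,
dummy queries `[]` after; the query generator replays the finished rounds from their blocks (an `FP`
loop of `iterate_mem_FP`, the state `⟨z.1, 1^R, zᵢ, unread answers⟩`, a round consuming a block while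
at least `R` answers are unread) and then asks round `i`'s next query; the output map replays all `N`
rounds from the `p(|z|)·R` answers. [cite: AroraBarak2009, §3.4 with §1.4.1 (clocked loops)] -/
theorem iterate {F : List Bool → List Bool} (hF : AdPres A F) (d : ℕ) (hd : ∀ w, (F w).length ≤ w.length + d)
    (p : Polynomial ℕ) : AdPres A (fun z => F^[p.eval (boolUnpair z).1.length] z) := by
  obtain ⟨Q, G, q, hQ, hG, hFx⟩ := hF
  -- the block length
  set Rp : Polynomial ℕ := q.comp (X + C d * p) with hRp
  -- projections of the replay state `S = ⟨c, ⟨r, ⟨zc, bits⟩⟩⟩`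
  set CC : List Bool → List Bool := fstF with hCC
  set RR : List Bool → List Bool := fstF ∘ sndF with hRR
  set ZC : List Bool → List Bool := fstF ∘ sndF ∘ sndF with hZC
  set BI : List Bool → List Bool := sndF ∘ sndF ∘ sndF with hBI
  have hCCm : CC ∈ FP := fstF_mem_FP
  have hRRm : RR ∈ FP := comp_mem_FP fstF_mem_FP sndF_mem_FP
  have hZCm : ZC ∈ FP := comp_mem_FP fstF_mem_FP (comp_mem_FP sndF_mem_FP sndF_mem_FP)
  have hBIm : BI ∈ FP := comp_mem_FP sndF_mem_FP (comp_mem_FP sndF_mem_FP sndF_mem_FP)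
  -- one round of `F` read off the block, clipped to additive growth: `Ft S = (G ⟨zc, bits ↾ q|zc|⟩) ↾ (|zc| + d)`
  set Ft : List Bool → List Bool :=
    takeFn ∘ fanoutFn (polyFn (X + C d) ∘ ZC) (G ∘ fanoutFn ZC (takeFn ∘ fanoutFn (polyFn q ∘ ZC) BI)) with hFt
  have hFtm : Ft ∈ FP := comp_mem_FP takeFn_mem_FP (fanoutFn_mem_FP (comp_mem_FP (polyFn_mem_FP _) hZCm)
    (comp_mem_FP hG (fanoutFn_mem_FP hZCm (comp_mem_FP takeFn_mem_FP (fanoutFn_mem_FP (comp_mem_FP (polyFn_mem_FP q) hZCm) hBIm)))))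
  -- the replay round: consume a block if at least `|r|` answers are unread
  set EL : List Bool → List Bool := fanoutFn CC (fanoutFn RR (fanoutFn Ft (dropFn ∘ fanoutFn RR BI))) with hEL
  have hELm : EL ∈ FP := fanoutFn_mem_FP hCCm (fanoutFn_mem_FP hRRm (fanoutFn_mem_FP hFtm (comp_mem_FP dropFn_mem_FP (fanoutFn_mem_FP hRRm hBIm))))
  set B : List Bool → List Bool := iteFn (ltLenF ∘ fanoutFn BI RR) (fun S => S) EL with hB
  have hBm : B ∈ FP := iteFn_mem_FP (comp_mem_FP ltLenF_mem_FP (fanoutFn_mem_FP hBIm hRRm)) id_mem_FP' hELm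
  -- growth of the replay round, on every string
  have hBgrowth : ∀ S, (B S).length ≤ S.length + (2 * d + 6) := by
    intro S
    have hcond : (ltLenF ∘ fanoutFn BI RR) S = [decide ((BI S).length < (RR S).length)] := by simp
    by_cases hlt : (BI S).length < (RR S).length
    · rw [hB, iteFn_apply_true (by rw [hcond, decide_eq_true hlt])]; omega
    · rw [hB, iteFn_apply_false (by rw [hcond, decide_eq_false hlt])]
      have h0 := length_fstF_sndF_le S
      have h1 := length_fstF_sndF_le (sndF S)
      have h2 := length_fstF_sndF_le (sndF (sndF S))
      have hFt' : (Ft S).length ≤ (fstF (sndF (sndF S))).length + d := by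
        rw [hFt]
        simp only [Function.comp_apply, fanoutFn_apply, takeFn_boolPair, polyFn_apply, length_ones, hZC]
        refine (List.length_take_le _ _).trans ?_
        simp
      rw [hEL]
      simp only [fanoutFn_apply, length_boolPair, Function.comp_apply, hCC, hRR, hBI, dropFn_boolPair, List.length_drop]
      omega
  -- the replay loop, its initialisation `⟨z, bs⟩ ↦ ⟨z.1, ⟨1^{R|z|}, ⟨z, bs⟩⟩⟩`, and the two programs
  set L : List Bool → List Bool := fun S => B^[p.eval (boolUnpair S).1.length] S with hL
  have hLm : L ∈ FP := iterate_mem_FP hBm (2 * d + 6) hBgrowth p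
  set INIT : List Bool → List Bool := fanoutFn (fstF ∘ fstF) (fanoutFn (polyFn Rp ∘ fstF) (fun w => w)) with hINIT
  have hINITm : INIT ∈ FP := fanoutFn_mem_FP (comp_mem_FP fstF_mem_FP fstF_mem_FP)
    (fanoutFn_mem_FP (comp_mem_FP (polyFn_mem_FP Rp) fstF_mem_FP) id_mem_FP')
  set QS : List Bool → List Bool :=
    iteFn (ltLenF ∘ fanoutFn BI (polyFn q ∘ ZC)) (Q ∘ fanoutFn ZC BI) (fun _ => []) ∘ L ∘ INIT with hQS
  set GS : List Bool → List Bool := ZC ∘ L ∘ INIT with hGS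
  refine ⟨QS, GS, p * Rp,
    comp_mem_FP (iteFn_mem_FP (comp_mem_FP ltLenF_mem_FP (fanoutFn_mem_FP hBIm (comp_mem_FP (polyFn_mem_FP q) hZCm)))
      (comp_mem_FP hQ (fanoutFn_mem_FP hZCm hBIm)) (const_mem_FP [])) (comp_mem_FP hLm hINITm),
    comp_mem_FP hZCm (comp_mem_FP hLm hINITm), fun z => ?_⟩
  /- ### correctness at `z` -/
  set c := fstF z with hc
  set N := p.eval c.length with hN
  set R := Rp.eval z.length with hR
  have hcz : c.length ≤ z.length := by have := length_fstF_sndF_le z; rw [← hc] at this; omega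
  have hNle : N ≤ p.eval z.length := TM2Iter.eval_mono p hcz
  -- the iterates and their lengths
  have hlen : ∀ i, (F^[i] z).length ≤ z.length + d * i := by
    intro i
    induction i with
    | zero => simp
    | succ i ih => rw [Function.iterate_succ_apply']; have := hd (F^[i] z); rw [Nat.mul_succ]; omega
  have hqR : ∀ i ≤ N, q.eval (F^[i] z).length ≤ R := fun i hi => by
    rw [hR, hRp, eval_comp]
    refine TM2Iter.eval_mono q ((hlen i).trans ?_)
    simp only [eval_add, eval_X, eval_mul, eval_C]
    have : d * i ≤ d * p.eval z.length := Nat.mul_le_mul_left d (hi.trans hNle)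
    omega
  -- the records
  have hINIT : ∀ bs, INIT (boolPair z bs) = boolPair c (boolPair (ones R) (boolPair z bs)) := fun bs => by
    rw [hINIT]; simp [← hc, ← hR]
  have hfstINIT : ∀ bs, (boolUnpair (INIT (boolPair z bs))).1 = c := fun bs => by
    rw [hINIT bs]; exact fstF_boolPair _ _
  have hB_lt : ∀ (zc t : List Bool), t.length < R → B (boolPair c (boolPair (ones R) (boolPair zc t))) =
      boolPair c (boolPair (ones R) (boolPair zc t)) := fun zc t ht => by
    rw [hB, iteFn_apply_true]
    simp [hBI, hRR, ht]
  have hB_ge : ∀ (zc t : List Bool), R ≤ t.length → B (boolPair c (boolPair (ones R) (boolPair zc t))) =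
      boolPair c (boolPair (ones R) (boolPair ((G (boolPair zc (t.take (q.eval zc.length)))).take (zc.length + d)) (t.drop R))) :=
    fun zc t ht => by
      rw [hB, iteFn_apply_false]
      · rw [hEL]; simp [hCC, hRR, hFt, hZC, hBI]
      · have : ¬ t.length < R := Nat.not_lt.2 ht
        simp [hBI, hRR, this]
  -- the true answer blocks
  set b0 := A.boolIndicator [] with hb0
  let β : ℕ → List Bool := fun i => adBits Q A (F^[i] z) (q.eval (F^[i] z).length)
  let blk : ℕ → List Bool := fun i => β i ++ List.replicate (R - q.eval (F^[i] z).length) b0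
  let pre : ℕ → List Bool := fun i => ((List.range i).map blk).flatten
  have hβlen : ∀ i, (β i).length = q.eval (F^[i] z).length := fun i => length_adBits A _ _
  have hblklen : ∀ i ≤ N, (blk i).length = R := fun i hi => by
    simp only [blk, List.length_append, hβlen, List.length_replicate]
    have := hqR i hi; omega
  have hpre_succ : ∀ i, pre (i + 1) = pre i ++ blk i := fun i => by
    simp only [pre, List.range_succ, List.map_append, List.map_singleton, List.flatten_append, List.flatten_singleton]
  -- replay: `i ≤ N` rounds of `B` consume the first `i` blocks and reach `F^[i] z`
  have hreplay : ∀ i ≤ N, ∀ t, B^[i] (boolPair c (boolPair (ones R) (boolPair z (pre i ++ t)))) =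
      boolPair c (boolPair (ones R) (boolPair (F^[i] z) t)) := by
    intro i
    induction i with
    | zero => intro _ t; simp [pre]
    | succ i ih =>
      intro hi t
      rw [Function.iterate_succ_apply', hpre_succ, List.append_assoc, ih (Nat.le_of_succ_le hi) (blk i ++ t),
        hB_ge _ _ (by rw [List.length_append, hblklen i (Nat.le_of_succ_le hi)]; omega)]
      have h1 : (blk i ++ t).take (q.eval (F^[i] z).length) = β i := by
        simp only [blk, List.append_assoc]; exact List.take_left' (hβlen i)
      have h2 : (blk i ++ t).drop R = t := List.drop_left' (hblklen i (Nat.le_of_succ_le hi))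
      have h3 : (G (boolPair (F^[i] z) (β i))).take ((F^[i] z).length + d) = F^[i + 1] z := by
        rw [← hFx, Function.iterate_succ_apply']
        exact List.take_of_length_le (hd _)
      rw [h1, h2, h3]
  -- the loop on `⟨z, pre i ++ t⟩` with a short tail `t` ends in `⟨c, 1^R, F^[i] z, t⟩`
  have hloop : ∀ i ≤ N, ∀ t, t.length < R → L (INIT (boolPair z (pre i ++ t))) = boolPair c (boolPair (ones R) (boolPair (F^[i] z) t)) := by
    intro i hi t ht
    rw [hL]
    dsimp only
    rw [hfstINIT, ← hN, hINIT, show N = (N - i) + i by omega, Function.iterate_add_apply, hreplay i hi t]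
    exact Function.iterate_fixed (hB_lt _ t ht) _
  -- the transcript, block by block: `γ i j` = the first `j` answers of block `i`
  let γ : ℕ → ℕ → List Bool := fun i j =>
    if j ≤ q.eval (F^[i] z).length then adBits Q A (F^[i] z) j else β i ++ List.replicate (j - q.eval (F^[i] z).length) b0
  have hγlen : ∀ i j, (γ i j).length = j := fun i j => by
    by_cases h : j ≤ q.eval (F^[i] z).length
    · simp only [γ, if_pos h, length_adBits]
    · simp only [γ, if_neg h, List.length_append, hβlen, List.length_replicate]; omega
  have hγ0 : ∀ i, γ i 0 = [] := fun i => by simp only [γ, if_pos (Nat.zero_le _), adBits_zero]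
  have hγR : ∀ i ≤ N, γ i R = blk i := fun i hi => by
    by_cases h : R ≤ q.eval (F^[i] z).length
    · have he : q.eval (F^[i] z).length = R := le_antisymm (hqR i hi) h
      simp only [γ, if_pos h, blk, β, he, Nat.sub_self, List.replicate_zero, List.append_nil]
    · simp only [γ, if_neg h, blk]
  have hstep : ∀ i ≤ N, ∀ j < R, adBits QS A z (i * R + j) = pre i ++ γ i j → adBits QS A z (i * R + j + 1) = pre i ++ γ i (j + 1) := by
    intro i hi j hj hij
    rw [adBits_succ, hij]
    -- the query after `pre i ++ γ i j`
    have hQv : QS (boolPair z (pre i ++ γ i j)) =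
        if j < q.eval (F^[i] z).length then Q (boolPair (F^[i] z) (γ i j)) else [] := by
      rw [hQS, Function.comp_apply, Function.comp_apply, hloop i hi _ (by rw [hγlen]; exact hj)]
      have hcond : (ltLenF ∘ fanoutFn BI (polyFn q ∘ ZC)) (boolPair c (boolPair (ones R) (boolPair (F^[i] z) (γ i j)))) =
          [decide (j < q.eval (F^[i] z).length)] := by simp [hBI, hZC, hγlen]
      by_cases hlt : j < q.eval (F^[i] z).length
      · rw [iteFn_apply_true (by rw [hcond, decide_eq_true hlt]), if_pos hlt]; simp [hZC, hBI]
      · rw [iteFn_apply_false (by rw [hcond, decide_eq_false hlt]), if_neg hlt]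
    rw [hQv]
    by_cases hlt : j < q.eval (F^[i] z).length
    · rw [if_pos hlt]
      have hj1 : γ i j = adBits Q A (F^[i] z) j := by simp only [γ, if_pos hlt.le]
      have hj2 : γ i (j + 1) = adBits Q A (F^[i] z) (j + 1) := by simp only [γ, if_pos (Nat.succ_le_of_lt hlt)]
      rw [hj1, hj2, adBits_succ, List.append_assoc]
    · rw [if_neg hlt]
      have hj2 : γ i (j + 1) = γ i j ++ [b0] := by
        have hnot : ¬ j + 1 ≤ q.eval (F^[i] z).length := fun h => hlt h
        by_cases heq : j ≤ q.eval (F^[i] z).length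
        · have hje : j = q.eval (F^[i] z).length := le_antisymm heq (Nat.not_lt.1 hlt)
          simp only [γ, if_pos heq, if_neg hnot, β]
          rw [← hje, Nat.add_sub_cancel_left, List.replicate_one]
        · simp only [γ, if_neg heq, if_neg hnot, List.append_assoc]
          rw [show j + 1 - q.eval (F^[i] z).length = (j - q.eval (F^[i] z).length) + 1 by omega, List.replicate_succ']
      rw [hj2, List.append_assoc]
  have hblocks : ∀ i ≤ N, ∀ j ≤ R, adBits QS A z (i * R + j) = pre i ++ γ i j := by
    intro i
    induction i with
    | zero =>
      intro _ j
      induction j with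
      | zero => intro _; simp [pre, hγ0]
      | succ j ih => intro hj; exact hstep 0 (Nat.zero_le _) j hj (ih (Nat.le_of_succ_le hj))
    | succ i ihi =>
      intro hi j
      induction j with
      | zero =>
        intro _
        rw [Nat.add_zero, Nat.succ_mul, ihi (Nat.le_of_succ_le hi) R le_rfl, hγR i (Nat.le_of_succ_le hi), hpre_succ, hγ0,
          List.append_nil]
      | succ j ih => intro hj; exact hstep (i + 1) hi j hj (ih (Nat.le_of_succ_le hj))
  -- the output map replays all `N` rounds from the full transcript
  have htot : N * R ≤ (p * Rp).eval z.length := by rw [eval_mul, ← hR]; exact Nat.mul_le_mul_right R hNle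
  set T := adBits QS A z ((p * Rp).eval z.length) with hT
  have hTsplit : T = pre N ++ T.drop (N * R) := by
    have h0 := hblocks N le_rfl 0 (Nat.zero_le _)
    rw [Nat.add_zero, hγ0, List.append_nil] at h0
    conv_lhs => rw [← List.take_append_drop (N * R) T]
    rw [hT, adBits_take A z htot, h0]
  change F^[p.eval (fstF z).length] z = GS (boolPair z T)
  rw [← hc, ← hN, hGS, Function.comp_apply, Function.comp_apply, hL]
  dsimp only
  rw [hfstINIT, ← hN, hINIT, hTsplit, hreplay N le_rfl]
  simp [hZC]

end AdPres

end AdQuery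

end Literature.Computability.Complexity
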